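import Summits.CriticalPhenomena.PercolationContinuityZ3.Theorems.Transplant.SqShadowSurgeryAtt
import Summits.CriticalPhenomena.PercolationContinuityZ3.Theorems.Transplant.SqShadowFact1
import HarnessLib

/-!
# SQUARE SHADOWS — port of «HexShadowSurgOut» to the square-shadow interface: the output of a recoverable LOCATED surgery (`SurgOut`), separated families of points of
# `ℤ²` (sup-norm squares for lattice squares: `card_filter_mem_sqBall_le`, `exists_separated_subset_sq`), and the surgery of the core files as such an output

builds on p205010 (kernel theorem, internal audit signed; external expert review pending) — NOT used in this file.  Lane `prim-bschramm`, seat `prim-bschramm-p2` (gen 42; class C1b;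
memo §148); helper file (`--supports stmt-CriticalPhenomena-4575 --as helper`).  Statements and proofs of §2 verbatim from the squareal twin with `Ψ : SqShadow G` for `Φ : HexShadow G`.
[cite: DuminilCopinSidoraviciusTassion2016, §2.3 (proof of Fact 2, pp. 6–7)]
-/

noncomputable section

namespace Summit.CriticalPhenomena.PercolationContinuityZ3.Theorems.Transplant

open MeasureTheory Literature.Probability.Percolation Literature.Probability.LatticeModels SimpleGraph Filter
open scoped Classical Topology

/-! ## §1 Counting and separating in `ℤ²` -/

/-- Membership in lattice squares is symmetric. [folklore] -/
theorem mem_sqBall_comm {z w : Site 2} {R : ℕ} : w ∈ sqBall z R ↔ z ∈ sqBall w R := by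
  rw [mem_sqBall, mem_sqBall, abs_sub_comm (w 0), abs_sub_comm (w 1)]

/-- **A lattice square of radius `R` has at most `(2R+1)²` points.** [folklore] -/
theorem card_filter_mem_sqBall_le (A : Finset (Site 2)) (z : Site 2) (R : ℕ) [DecidablePred (· ∈ sqBall z R)] :
    (A.filter (· ∈ sqBall z R)).card ≤ (2 * R + 1) ^ 2 := by
  set f : Site 2 → ℤ × ℤ := fun w => (w 0, w 1) with hf
  have hinj : Set.InjOn f ↑(A.filter (· ∈ sqBall z R)) := by
    intro a _ b _ h
    simp only [hf, Prod.mk.injEq] at h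
    exact Site.eq_iff_two.2 h
  have hmaps : ∀ w ∈ A.filter (· ∈ sqBall z R), f w ∈ (Finset.Icc (z 0 - R) (z 0 + R)) ×ˢ (Finset.Icc (z 1 - R) (z 1 + R)) := by
    intro w hw
    obtain ⟨-, hw⟩ := Finset.mem_filter.1 hw
    rw [mem_sqBall_iff_linear] at hw
    simp only [hf, Finset.mem_product, Finset.mem_Icc]
    omega
  refine (Finset.card_le_card_of_injOn f hmaps hinj).trans ?_
  rw [Finset.card_product, Int.card_Icc, Int.card_Icc]
  have e0 : (z 0 + R + 1 - (z 0 - R)).toNat = 2 * R + 1 := by omega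
  have e1 : (z 1 + R + 1 - (z 1 - R)).toNat = 2 * R + 1 := by omega
  rw [e0, e1]; ring_nf; rfl

/-- The number of points of a lattice square. [folklore] -/
theorem card_toFinset_sqBall_le (z : Site 2) (R : ℕ) : (sqBall_finite z R).toFinset.card ≤ (2 * R + 1) ^ 2 := by
  classical
  have : (sqBall_finite z R).toFinset = (sqBall_finite z R).toFinset.filter (· ∈ sqBall z R) := by ext w; simp
  rw [this]
  exact card_filter_mem_sqBall_le _ z R

/-- **Greedy separated subfamily**: a finite set `A ⊆ ℤ²` contains a subset `Sel`, any two distinct points of which are at sup-distance `> R`, with `|A| ≤ (2R+1)² |Sel|`. [folklore] -/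
theorem exists_separated_subset_sq (R : ℕ) : ∀ (A : Finset (Site 2)), ∃ Sel : Finset (Site 2), Sel ⊆ A ∧
    (∀ z ∈ Sel, ∀ z' ∈ Sel, z ≠ z' → z' ∉ sqBall z R) ∧ A.card ≤ (2 * R + 1) ^ 2 * Sel.card := by
  classical
  intro A
  induction A using Finset.strongInduction with
  | H A ih =>
    rcases A.eq_empty_or_nonempty with rfl | ⟨z, hz⟩
    · exact ⟨∅, Finset.empty_subset _, by simp, by simp⟩
    · set A' := A.filter (· ∉ sqBall z R) with hA'
      have hzz : z ∈ sqBall z R := centre_mem_sqBall z R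
      have hA'A : A' ⊂ A := by
        refine Finset.ssubset_iff_subset_ne.2 ⟨Finset.filter_subset _ _, fun h => ?_⟩
        have : z ∈ A' := by rw [h]; exact hz
        exact (Finset.mem_filter.1 this).2 hzz
      obtain ⟨Sel', hSel'A', hsep', hcard'⟩ := ih A' hA'A
      have hzSel' : z ∉ Sel' := fun h => (Finset.mem_filter.1 (hSel'A' h)).2 hzz
      refine ⟨insert z Sel', ?_, ?_, ?_⟩
      · exact Finset.insert_subset hz (hSel'A'.trans (Finset.filter_subset _ _))
      · intro w hw w' hw' hne
        rw [Finset.mem_insert] at hw hw'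
        rcases hw with rfl | hw <;> rcases hw' with rfl | hw'
        · exact absurd rfl hne
        · exact (Finset.mem_filter.1 (hSel'A' hw')).2
        · intro hmem
          exact (Finset.mem_filter.1 (hSel'A' hw)).2 (mem_sqBall_comm.1 hmem)
        · exact hsep' w hw w' hw' hne
      · have hsplit : A.card ≤ (A.filter (· ∈ sqBall z R)).card + A'.card := by
          rw [hA', Finset.card_filter_add_card_filter_not]
        have hbox := card_filter_mem_sqBall_le A z R
        rw [Finset.card_insert_of_notMem hzSel']
        nlinarith

/-- Two points at sup-distance `≤ 3` from a common point are at distance `≤ 6`. [folklore] -/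
theorem mem_sqBall_six_of_three {z z' q : Site 2} (hq : q ∈ sqBall z 3) (hq' : q ∈ sqBall z' 3) : z' ∈ sqBall z 6 := by
  rw [mem_sqBall_iff_linear] at hq hq' ⊢
  omega

/-- A square of radius `r` about `z` lies in the square of radius `r + 3` about any point of `sqBall z 3`. [folklore] -/
theorem sqBall_subset_sqBall_add_three {z q : Site 2} (hq : q ∈ sqBall z 3) (r : ℕ) : sqBall z r ⊆ sqBall q (r + 3) := by
  intro w hw
  rw [mem_sqBall_iff_linear] at hq hw ⊢
  push_cast; omega

namespace SqShadow

variable {V : Type} {G : SimpleGraph V} (Ψ : SqShadow G) [Countable V]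

omit [Countable V] in
/-- `touch` is monotone in the set of columns. [folklore] -/
theorem touch_mono {D D' : Set (Site 2)} (h : D ⊆ D') : Ψ.touch D ⊆ Ψ.touch D' := by
  rintro e ⟨x, hx, hxD⟩
  exact ⟨x, hx, h hxD⟩

/-! ## §2 Located surgery outputs -/

/-- **The output of one recoverable local surgery of `ω` located at `z ∈ 𝕋`** (what the proof of Fact 2 uses of DST's `ω^{(z)}`): `ω' ∈ C`; `ω'` consists of
edges of `ω` and lattice edges over the window; `ω'` agrees with `ω` off the pairs touching `\overline{sqBall z r}`; `Att(ω') ≠ ∅` lies over `sqBall z 3`.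
[cite: DuminilCopinSidoraviciusTassion2016, §2.3, proof of Fact 2 (pp. 6–7)] -/
structure SurgOut (Γ : GlueData) (r : ℕ) (ω : BondConfig V) (z : Site 2) (ω' : BondConfig V) : Prop where
  /-- the new configuration realises `C` -/
  mem_evC : ω' ∈ Ψ.evC Γ
  /-- it consists of old edges and lattice edges of the window -/
  subset_window : ω' ⊆ ω ∪ (G.edgeSet ∩ (Ψ.lift (Ψ.big Γ ∪ Ψ.small Γ)).sym2)
  /-- it agrees with `ω` off the pairs touching `\overline{sqBall z r}` -/
  agree_off : ∀ e, e ∉ Ψ.touch (sqBall z r) → (e ∈ ω' ↔ e ∈ ω)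
  /-- the attachment statistic is non-empty -/
  att_nonempty : (Ψ.att Γ ω').Nonempty
  /-- and lies over `sqBall z 3` -/
  att_near : ∀ q ∈ Ψ.att Γ ω', Ψ.sh q ∈ sqBall z 3

/-- Enlarging the radius. [folklore] -/
theorem SurgOut.mono {Γ : GlueData} {r r' : ℕ} (hr : r ≤ r') {ω ω' : BondConfig V} {z : Site 2} (h : Ψ.SurgOut Γ r ω z ω') : Ψ.SurgOut Γ r' ω z ω' where
  mem_evC := h.mem_evC
  subset_window := h.subset_window
  agree_off := fun e he => h.agree_off e fun he' => he (Ψ.touch_mono (sqBall_mono z hr) he')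
  att_nonempty := h.att_nonempty
  att_near := h.att_near

variable {Ψ}

/-- The new configuration of a surgery consists of old edges and of lattice edges over the window. [folklore] -/
theorem Surgery.mem_window_of_mem_newConfig {Γ : GlueData} {ω : BondConfig V} (sg : Ψ.Surgery Γ ω) (hA : ω ∈ Ψ.evA Γ) {e : Sym2 V}
    (he : e ∈ sg.newConfig) : e ∈ ω ∨ (e ∈ G.edgeSet ∧ e ∈ (Ψ.lift (Ψ.big Γ ∪ Ψ.small Γ)).sym2) := by
  rcases sg.newConfig_subset hA he with h | h
  · exact Or.inl h
  · right
    refine ⟨?_, ?_⟩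
    · rcases h with h | h
      · exact edgesOf_subset_edgeSet sg.hSPchain h
      · exact edgesOf_subset_edgeSet sg.hBrchain h
    · induction e using Sym2.ind with
      | h a b =>
        obtain ⟨ha, hb⟩ := sg.structEdges_Sw h
        exact Set.mk_mem_sym2_iff.2 ⟨sg.hD (sg.Sw_D ha), sg.hD (sg.Sw_D hb)⟩

/-- **The surgery of the core files is a recoverable located surgery**: for `ω ∈ 𝒳` and data with cleared columns `D ⊆ sqBall z 3`, `ω^{(z)}` is an output
located at `z` with radius `3`. [cite: DuminilCopinSidoraviciusTassion2016, §2.3, proof of Fact 2 (pp. 6–7)] -/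
theorem Surgery.surgOut {Γ : GlueData} {ω : BondConfig V} (sg : Ψ.Surgery Γ ω) (hX : ω ∈ Ψ.evX Γ) {z : Site 2} (hD : sg.D ⊆ sqBall z 3) :
    Ψ.SurgOut Γ 3 ω z sg.newConfig where
  mem_evC := sg.newConfig_mem_evC hX
  subset_window := fun e he => by
    rcases sg.mem_window_of_mem_newConfig hX.1.1.1 he with h | ⟨h1, h2⟩
    · exact Or.inl h
    · exact Or.inr ⟨h1, h2⟩
  agree_off := fun e he => sg.mem_newConfig_iff_of_not_touch fun h => he (Ψ.touch_mono hD h)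
  att_nonempty := sg.att_nonempty hX
  att_near := fun q hq => by
    have := sg.att_subset hX hq
    rw [mem_lift] at this
    exact hD this

end SqShadow

end Summit.CriticalPhenomena.PercolationContinuityZ3.Theorems.Transplant

end
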